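import Summits.FinalStateConjecture.FinalStateConjecture.Theses.CurvatureOrSymmetry
import Literature.Geometry.Lorentzian.TameGenericityLocal

/-!
# Route CurvatureOrSymmetry — `TameLocalExitSuffices` (item `stmt-FinalStateConjecture-17350`)

`TameLocalExitSuffices_proof : Theses.CurvatureOrSymmetry.TameLocalExitSuffices`: a LOCAL good tame
exit through a datum `D` (an end `e` and a tame, immersed-at-`0`, injective admissible one-parameter
family `F` on `e` with `F 0 = D` whose members with `0 < ‖c‖ < ε` avoid the exceptional set `𝓔`) is
turned into a GLOBAL one on the same end `e` (all members with `c ≠ 0` avoid `𝓔`). This is exactly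
the bookkeeping lemma `InitialDataSet.exists_tameFamily_of_local` of
`Literature/Geometry/Lorentzian/TameGenericityLocal.lean` (radial reparametrisation
`c ↦ ε (1 + ‖c‖²)^{-1/2} c` of the parameter line into the `ε`-ball: tameness composes by
`IsTameDataFamily.comp_contDiff`, immersion at `0` by `IsImmersedAtZero.comp_of_injective_fderiv`
(differential `ε • id`), injectivity composes, `F' 0 = F 0 = D`), applied with `P := (· ∉ 𝓔)` and
`𝓓 := admissibleVacuumData X`. Pure calculus and logic; Christodoulou, CQG 16 (1999) A23, p. A24,
only motivates the notion of a family through `D` (positive codimension is local in the parameter).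
-/

-- every `Summit.FinalStateConjecture.FinalStateConjecture.…` name repeats the summit = sub-problem
-- segment (D-0017 layout, CONVENTIONS §2); the duplicate is deliberate.
set_option linter.dupNamespace false

noncomputable section

namespace Summit.FinalStateConjecture.FinalStateConjecture.Theorems

open Literature.Geometry.Lorentzian
open scoped Manifold ContDiff Topology

/-- **`TameLocalExitSuffices` (item `stmt-FinalStateConjecture-17350` of route `CurvatureOrSymmetry`)
holds.** If through `D` passes, on the end `e`, a tame (`IsTameDataFamily e 1 F`), immersed-at-`0`
(`IsImmersedAtZero 1 F`), injective admissible one-parameter family `F` with `F 0 = D` whose members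
with `0 < ‖c‖ < ε` avoid `𝓔`, then the radially reparametrised family
(`InitialDataSet.exists_tameFamily_of_local` with `P := (· ∉ 𝓔)`) is again tame on `e`, immersed at
`0`, injective, admissible, passes through `D` at `0`, and ALL its members with `c ≠ 0` avoid `𝓔`. -/
theorem TameLocalExitSuffices_proof :
    Summit.FinalStateConjecture.FinalStateConjecture.Theses.CurvatureOrSymmetry.TameLocalExitSuffices := by
  unfold Theses.CurvatureOrSymmetry.TameLocalExitSuffices
  intro X _ _ _ _ _ _ 𝓔 D hloc
  obtain ⟨e, F, hF, himm, h0, hinj, hadm, ε, hε, hgood⟩ := hloc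
  obtain ⟨F', hF', hF'0, hinj', himm', hadm', hgood'⟩ :=
    InitialDataSet.exists_tameFamily_of_local (P := fun d ↦ d ∉ 𝓔) hF himm hinj hadm hε hgood
  exact ⟨e, F', hF', himm', hF'0.trans h0, hinj', hadm', fun c hc ↦ hgood' c hc⟩

end Summit.FinalStateConjecture.FinalStateConjecture.Theorems

end
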